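import Summits.KontsevichZagierPeriods.KontsevichZagierPeriods.Theses.PhiFourHepp
import Summits.KontsevichZagierPeriods.KontsevichZagierPeriods.Theorems.PhiFourHeppKernelOfSummitR
import Literature.NumberTheory.Transcendental.KZKernelConjectureForms

/-!
# Route PhiFourHepp — crux `PhiFourKernelH` (stmt-KontsevichZagierPeriods-12286): strength theorems

Redirect-strategist file (unit `cstrat-stmt-KontsevichZagierPeriods-12286-r1`, `--supports` the crux).
It lands, as citable theorems over the ROUTE DECLARATIONS ONLY (no new definition), the logical
position of the route's rank-0 crux

  `K := PhiFourKernelH = ∀ c, KZ.eval c = 0 → c ∈ AddSubgroup.closure (moves ∪ S_H)`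

(the kernel form of the KZ calculus ENLARGED by the Hepp relator scheme `S_H`), on which two
strategist censuses returned `no-strategy-short-of-summit`:

* §1 is SCHEMATIC in the relator scheme `S' : Set KZ.FormalRep` (so that the same theorems serve
  every "enlarged calculus" crux of this summit): the enlarged kernel form is EQUIVALENT to
  Kontsevich–Zagier's Conjecture 1 stated verbatim (KZ-literal two-representation form, the shape
  of `KontsevichZagierPeriods` itself) for the enlarged calculus
  (`kernelFormEnlarged_iff_conjectureOne_enlarged`); it is implied by the summit
  (`kernelFormEnlarged_of_summit`); it gives the summit back as soon as the scheme is derivable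
  (`summit_of_kernelFormEnlarged`), hence `S' ⊆ relations → (enlarged kernel form ↔ summit)`;
  and the JOINT reading `(summit ∧ S' value-sound) ↔ (S' ⊆ relations ∧ enlarged kernel form)`
  (`summit_and_sound_iff_subset_and_kernelFormEnlarged`) — the two halves of a route of this
  shape are a CONJUNCT SPLIT of "the summit plus the value-soundness of the scheme", the kernel
  half being the complement (residual) of the derivability half; finally
  `summit_of_sufficient_for_kernelFormEnlarged`: any sufficient condition for the enlarged kernel
  form is, given derivability of the scheme, already sufficient for the summit (every
  decomposition of the kernel half is a decomposition of the summit relative to the other half).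
* §2 instantiates `S' := S_H` BY `Iff.rfl` / `rintro` on the route's literal bodies:
  `phiFourKernelH_iff_summit_of_tropicalLifting : TropicalLifting → (PhiFourKernelH ↔ summit)`,
  `phiFourKernelH_iff_conjectureOne_heppEnlarged` (the crux is verbatim Conjecture 1 of `KZ^H`),
  `tropicalLifting_iff_heppScheme_subset_relations`, `heppValueSound_of_tropicalLifting`
  (Panzer's Conj. 1.2 (⇐) in the crux's inlined coordinates follows from the bet, by soundness),
  `summit_and_heppValueSound_iff_cruxes : (summit ∧ HeppValueSound) ↔ (TropicalLifting ∧ PhiFourKernelH)`,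
  and `summit_of_sufficient_for_phiFourKernelH`.

References: M. Kontsevich, D. Zagier, *Periods* (2001), §1.2 Conjecture 1 [KontsevichZagier2001];
A. Huber, S. Müller-Stach, *Periods and Nori Motives* (2017), Conj. 13.2.1, Rem. 13.2.2
[HuberMullerStach2017]; E. Panzer, *Hepp's bound for Feynman graphs and matroids*, AIHPD 10 (2023)
= arXiv:1908.09820, Thm 1.1, Conj. 1.2 [Panzer2022].
-/

noncomputable section

namespace Summit.KontsevichZagierPeriods.PhiFourHepp

open Literature.NumberTheory.Transcendental
open Summit.KontsevichZagierPeriods.KontsevichZagierPeriods.Theses.PhiFourHepp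

/-! ## §1 Enlarged calculi: schematic theorems in the relator scheme `S'` -/

/-- `KZ.relations = closure (moves) ≤ closure (moves ∪ S')` for every relator scheme `S'`. [folklore] -/
theorem relations_le_closure_moves_union (S' : Set KZ.FormalRep) :
    KZ.relations ≤ AddSubgroup.closure (Literature.NumberTheory.Transcendental.KZ.domainAddRel ∪ Literature.NumberTheory.Transcendental.KZ.integrandAddRel ∪ Literature.NumberTheory.Transcendental.KZ.changeOfVariablesRel ∪ Literature.NumberTheory.Transcendental.KZ.newtonLeibnizRel ∪ S') :=
  AddSubgroup.closure_mono Set.subset_union_left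

/-- **Summit ⇒ enlarged kernel form**, for every scheme `S'`: the summit is the kernel form
`ker eval = relations` (`kzKernelConjecture_iff_isRational`, in tree) and closure is monotone.
[cite: KontsevichZagier2001, §1.2 Conjecture 1] -/
theorem kernelFormEnlarged_of_summit (S' : Set KZ.FormalRep) (h : KontsevichZagierPeriods) :
    ∀ c : KZ.FormalRep, KZ.eval c = 0 → c ∈ AddSubgroup.closure (Literature.NumberTheory.Transcendental.KZ.domainAddRel ∪ Literature.NumberTheory.Transcendental.KZ.integrandAddRel ∪ Literature.NumberTheory.Transcendental.KZ.changeOfVariablesRel ∪ Literature.NumberTheory.Transcendental.KZ.newtonLeibnizRel ∪ S') := by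
  intro c hc
  have hK : KZKernelConjecture :=
    kzKernelConjecture_iff_isRational.mpr (KontsevichZagierPeriods_iff.mp h)
  exact relations_le_closure_moves_union S' (hK c hc)

/-- **Derivable scheme: enlarged kernel form ⇒ summit.** If every relator of `S'` is already a
KZ relation, the enlarged closure is `KZ.relations` and the enlarged kernel form is the kernel
form of Conjecture 1, i.e. the summit. [cite: KontsevichZagier2001, §1.2 Conjecture 1] -/
theorem summit_of_kernelFormEnlarged (S' : Set KZ.FormalRep)
    (hS : S' ⊆ (KZ.relations : Set KZ.FormalRep))
    (h : ∀ c : KZ.FormalRep, KZ.eval c = 0 → c ∈ AddSubgroup.closure (Literature.NumberTheory.Transcendental.KZ.domainAddRel ∪ Literature.NumberTheory.Transcendental.KZ.integrandAddRel ∪ Literature.NumberTheory.Transcendental.KZ.changeOfVariablesRel ∪ Literature.NumberTheory.Transcendental.KZ.newtonLeibnizRel ∪ S')) :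
    KontsevichZagierPeriods := by
  have hle : AddSubgroup.closure (Literature.NumberTheory.Transcendental.KZ.domainAddRel ∪ Literature.NumberTheory.Transcendental.KZ.integrandAddRel ∪ Literature.NumberTheory.Transcendental.KZ.changeOfVariablesRel ∪ Literature.NumberTheory.Transcendental.KZ.newtonLeibnizRel ∪ S') ≤ KZ.relations :=
    (AddSubgroup.closure_le _).2 (Set.union_subset (fun _ hx => AddSubgroup.subset_closure hx) hS)
  exact KontsevichZagierPeriods_iff.mpr
    (kzKernelConjecture_iff_isRational.mp fun c hc => hle (h c hc))

/-- Hence, for a derivable scheme, **enlarged kernel form ⇔ summit**. [cite: KontsevichZagier2001, §1.2 Conjecture 1] -/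
theorem kernelFormEnlarged_iff_summit (S' : Set KZ.FormalRep)
    (hS : S' ⊆ (KZ.relations : Set KZ.FormalRep)) :
    (∀ c : KZ.FormalRep, KZ.eval c = 0 → c ∈ AddSubgroup.closure (Literature.NumberTheory.Transcendental.KZ.domainAddRel ∪ Literature.NumberTheory.Transcendental.KZ.integrandAddRel ∪ Literature.NumberTheory.Transcendental.KZ.changeOfVariablesRel ∪ Literature.NumberTheory.Transcendental.KZ.newtonLeibnizRel ∪ S')) ↔
      KontsevichZagierPeriods :=
  ⟨summit_of_kernelFormEnlarged S' hS, kernelFormEnlarged_of_summit S'⟩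

/-- **Enlarged kernel form ⇔ Conjecture 1 of the enlarged calculus, verbatim.** For EVERY relator
scheme `S'`, "every value-`0` formal combination lies in `closure (moves ∪ S')`" is equivalent to
Kontsevich–Zagier's Conjecture 1 in its printed, KZ-literal two-representation shape (two
representations of §1.1-shape — rational integrand over a `ℚ`-semialgebraic domain — with the same
value are connected) for the calculus whose rules are 1), 2), 3) AND the scheme `S'`. Proof: (⇒)
take `c = [r] − [r']`; (⇐) every `c` is `≡ [r] − [r']` modulo moves (`KZ.exists_integralRep_sub`),
each of `r, r'` is move-equivalent to a rational-shape representation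
(`KZ.exists_isRational_equivalent`), soundness transports the values, and the four differences
add up to `c`. So an enlarged-kernel crux is literally the summit statement of a sibling calculus.
[cite: KontsevichZagier2001, §1.2 Conjecture 1] [cite: HuberMullerStach2017, Conj. 13.2.1] -/
theorem kernelFormEnlarged_iff_conjectureOne_enlarged (S' : Set KZ.FormalRep) :
    (∀ c : KZ.FormalRep, KZ.eval c = 0 → c ∈ AddSubgroup.closure (Literature.NumberTheory.Transcendental.KZ.domainAddRel ∪ Literature.NumberTheory.Transcendental.KZ.integrandAddRel ∪ Literature.NumberTheory.Transcendental.KZ.changeOfVariablesRel ∪ Literature.NumberTheory.Transcendental.KZ.newtonLeibnizRel ∪ S')) ↔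
      ∀ ⦃n m : ℕ⦄ (r : KZ.IntegralRep n) (r' : KZ.IntegralRep m),
        r.IsRational → r'.IsRational → r.value = r'.value →
          KZ.of r - KZ.of r' ∈ AddSubgroup.closure (Literature.NumberTheory.Transcendental.KZ.domainAddRel ∪ Literature.NumberTheory.Transcendental.KZ.integrandAddRel ∪ Literature.NumberTheory.Transcendental.KZ.changeOfVariablesRel ∪ Literature.NumberTheory.Transcendental.KZ.newtonLeibnizRel ∪ S') := by
  constructor
  · intro h n m r r' _ _ hv
    exact h _ (by rw [KZ.eval_of_sub_of, hv, sub_self])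
  · intro h c hc
    obtain ⟨n, m, r, r', hrel⟩ := KZ.exists_integralRep_sub_holds c
    obtain ⟨N, R, hR, hrR⟩ := KZ.exists_isRational_equivalent_holds r
    obtain ⟨N', R', hR', hrR'⟩ := KZ.exists_isRational_equivalent_holds r'
    have hker : KZ.eval (c - (KZ.of r - KZ.of r')) = 0 := KZ.relations_le_ker_eval_holds hrel
    rw [map_sub, hc, zero_sub, neg_eq_zero, KZ.eval_of_sub_of, sub_eq_zero] at hker
    have hvR : R.value = R'.value := by
      rw [← KZ.Equivalent.value_eq_holds hrR, ← KZ.Equivalent.value_eq_holds hrR', hker]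
    have hRR' : KZ.of R - KZ.of R' ∈ AddSubgroup.closure (Literature.NumberTheory.Transcendental.KZ.domainAddRel ∪ Literature.NumberTheory.Transcendental.KZ.integrandAddRel ∪ Literature.NumberTheory.Transcendental.KZ.changeOfVariablesRel ∪ Literature.NumberTheory.Transcendental.KZ.newtonLeibnizRel ∪ S') := h R R' hR hR' hvR
    have h1 : c - (KZ.of r - KZ.of r') ∈ AddSubgroup.closure (Literature.NumberTheory.Transcendental.KZ.domainAddRel ∪ Literature.NumberTheory.Transcendental.KZ.integrandAddRel ∪ Literature.NumberTheory.Transcendental.KZ.changeOfVariablesRel ∪ Literature.NumberTheory.Transcendental.KZ.newtonLeibnizRel ∪ S') :=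
      relations_le_closure_moves_union S' hrel
    have h2 : KZ.of r - KZ.of R ∈ AddSubgroup.closure (Literature.NumberTheory.Transcendental.KZ.domainAddRel ∪ Literature.NumberTheory.Transcendental.KZ.integrandAddRel ∪ Literature.NumberTheory.Transcendental.KZ.changeOfVariablesRel ∪ Literature.NumberTheory.Transcendental.KZ.newtonLeibnizRel ∪ S') :=
      relations_le_closure_moves_union S' hrR
    have h3 : KZ.of r' - KZ.of R' ∈ AddSubgroup.closure (Literature.NumberTheory.Transcendental.KZ.domainAddRel ∪ Literature.NumberTheory.Transcendental.KZ.integrandAddRel ∪ Literature.NumberTheory.Transcendental.KZ.changeOfVariablesRel ∪ Literature.NumberTheory.Transcendental.KZ.newtonLeibnizRel ∪ S') :=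
      relations_le_closure_moves_union S' hrR'
    have key : c = (c - (KZ.of r - KZ.of r')) + (KZ.of r - KZ.of R) + (KZ.of R - KZ.of R') -
        (KZ.of r' - KZ.of R') := by abel
    rw [key]
    exact sub_mem (add_mem (add_mem h1 h2) hRR') h3

/-- **Joint (conjunct) reading.** For every scheme `S'`:
`(summit ∧ every relator of S' has value 0) ↔ (S' ⊆ relations ∧ enlarged kernel form)`.
(⇒) the summit's kernel form derives every value-`0` relator and implies the enlarged kernel form;
(⇐) a derivable scheme makes the enlarged kernel form the summit, and relations are value-sound
(`KZ.relations_le_ker_eval`). So a route `closes : (S' ⊆ relations) → (enlarged kernel form) → summit`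
attacks the conjunct `S' ⊆ relations` of "summit + value-soundness of `S'`", and its kernel crux is
the complementary conjunct. [cite: KontsevichZagier2001, §1.2 Conjecture 1] -/
theorem summit_and_sound_iff_subset_and_kernelFormEnlarged (S' : Set KZ.FormalRep) :
    (KontsevichZagierPeriods ∧ ∀ d ∈ S', KZ.eval d = 0) ↔
      (S' ⊆ (KZ.relations : Set KZ.FormalRep) ∧
        ∀ c : KZ.FormalRep, KZ.eval c = 0 → c ∈ AddSubgroup.closure (Literature.NumberTheory.Transcendental.KZ.domainAddRel ∪ Literature.NumberTheory.Transcendental.KZ.integrandAddRel ∪ Literature.NumberTheory.Transcendental.KZ.changeOfVariablesRel ∪ Literature.NumberTheory.Transcendental.KZ.newtonLeibnizRel ∪ S')) := by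
  constructor
  · rintro ⟨h, hS⟩
    have hK : KZKernelConjecture :=
      kzKernelConjecture_iff_isRational.mpr (KontsevichZagierPeriods_iff.mp h)
    exact ⟨fun d hd => hK d (hS d hd), kernelFormEnlarged_of_summit S' h⟩
  · rintro ⟨hS, h⟩
    exact ⟨summit_of_kernelFormEnlarged S' hS h, fun d hd =>
      (AddMonoidHom.mem_ker).1 (KZ.relations_le_ker_eval_holds (hS hd))⟩

/-- **Decompositions transfer.** Any sufficient condition `X` for the enlarged kernel form is,
together with derivability of the scheme, sufficient for the summit: every decomposition
`X₁ ∧ … ∧ X_k → (enlarged kernel form)` is a decomposition of the summit RELATIVE TO the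
derivability crux — the structural reason an enlarged-kernel crux admits no strategy short of the
summit that its sibling crux does not already condition. [folklore] -/
theorem summit_of_sufficient_for_kernelFormEnlarged (S' : Set KZ.FormalRep) {X : Prop}
    (hX : X → ∀ c : KZ.FormalRep, KZ.eval c = 0 → c ∈ AddSubgroup.closure (Literature.NumberTheory.Transcendental.KZ.domainAddRel ∪ Literature.NumberTheory.Transcendental.KZ.integrandAddRel ∪ Literature.NumberTheory.Transcendental.KZ.changeOfVariablesRel ∪ Literature.NumberTheory.Transcendental.KZ.newtonLeibnizRel ∪ S'))
    (hS : S' ⊆ (KZ.relations : Set KZ.FormalRep)) (x : X) : KontsevichZagierPeriods :=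
  summit_of_kernelFormEnlarged S' hS (hX x)

/-- Conversely the summit is itself such a sufficient condition, so the sufficient conditions for
an enlarged kernel form are sandwiched between those for the summit and those for
"derivability ⇒ summit". [folklore] -/
theorem sufficient_for_kernelFormEnlarged_of_sufficient_for_summit (S' : Set KZ.FormalRep) {X : Prop}
    (hX : X → KontsevichZagierPeriods) (x : X) :
    ∀ c : KZ.FormalRep, KZ.eval c = 0 → c ∈ AddSubgroup.closure (Literature.NumberTheory.Transcendental.KZ.domainAddRel ∪ Literature.NumberTheory.Transcendental.KZ.integrandAddRel ∪ Literature.NumberTheory.Transcendental.KZ.changeOfVariablesRel ∪ Literature.NumberTheory.Transcendental.KZ.newtonLeibnizRel ∪ S') :=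
  kernelFormEnlarged_of_summit S' (hX x)

/-! ## §2 The Hepp scheme `S_H` of route PhiFourHepp -/

/-- **Given the route's bet, the crux IS the summit**: `TropicalLifting → (PhiFourKernelH ↔
KontsevichZagierPeriods)` — (⇒) is the route's deciding theorem `closes`, (⇐) is the landed
`kernelOfSummitR_proof` (summit ⇒ crux unconditionally). [cite: KontsevichZagier2001, §1.2 Conjecture 1] [cite: Panzer2022, Conj. 1.2] -/
theorem phiFourKernelH_iff_summit_of_tropicalLifting (hT : TropicalLifting) :
    PhiFourKernelH ↔ KontsevichZagierPeriods :=
  ⟨closes hT, kernelOfSummitR_proof⟩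

/-- **`TropicalLifting` is literally "the Hepp scheme is derivable"**: `S_H ⊆ KZ.relations`, where
`S_H` is the set-builder inlined in `PhiFourKernelH` (the `rintro` pattern of `closes`). [cite: Panzer2022, Conj. 1.2] -/
theorem tropicalLifting_iff_heppScheme_subset_relations :
    TropicalLifting ↔
      {d : Literature.NumberTheory.Transcendental.KZ.FormalRep | ∃ (k₁ k₂ : ℕ) (E₁ : Fin (2*k₁+2) → Fin (k₁+2) × Fin (k₁+2)) (E₂ : Fin (2*k₂+2) → Fin (k₂+2) × Fin (k₂+2)) (r₁ : Literature.NumberTheory.Transcendental.KZ.IntegralRep (2*k₁+1)) (r₂ : Literature.NumberTheory.Transcendental.KZ.IntegralRep (2*k₂+1)), (∀ v, (Finset.univ.filter fun e => (E₁ e).1 = v ∨ (E₁ e).2 = v).card ≤ 4) ∧ (∀ v, (Finset.univ.filter fun e => (E₂ e).1 = v ∨ (E₂ e).2 = v).card ≤ 4) ∧ r₁.domain = {x | ∀ j, 0 < x j} ∧ Set.EqOn r₁.integrand (fun x => 1 / ((Matrix.fromBlocks (Matrix.diagonal (Fin.snoc x (1:ℝ) : Fin (2*k₁+2) → ℝ))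 (Matrix.of fun (e : Fin (2*k₁+2)) (j : Fin (k₁+1)) => ((if (E₁ e).1 = j.succ then (1:ℝ) else 0) - (if (E₁ e).2 = j.succ then (1:ℝ) else 0))) (-(Matrix.of fun (e : Fin (2*k₁+2)) (j : Fin (k₁+1)) => ((if (E₁ e).1 = j.succ then (1:ℝ) else 0) - (if (E₁ e).2 = j.succ then (1:ℝ) else 0))).transpose) (0 : Matrix (Fin (k₁+1)) (Fin (k₁+1)) ℝ)).det) ^ 2) r₁.domain ∧ r₂.domain = {x | ∀ j, 0 < x j} ∧ Set.EqOn r₂.integrand (fun x => 1 / ((Matrix.fromBlocks (Matrix.diagonal (Fin.snoc x (1:ℝ) : Fin (2*k₂+2) → ℝ)) (Matrix.of fun (e : Fin (2*k₂+2)) (j : Fin (k₂+1)) => ((if (E₂ e).1 = j.succ then (1:ℝ) else 0) - (if (E₂ e).2 = j.succ then (1:ℝ) else 0))) (-(Matrix.of fun (e : Fin (2*k₂+2)) (j : Fin (k₂+1)) => ((if (E₂ e).1 = j.succ then (1:ℝ) else 0) - (if (E₂ e).2 = j.succ then (1:ℝ) else 0))).transpose) (0 : Matrix (Fin (k₂+1))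 (Fin (k₂+1)) ℝ)).det) ^ 2) r₂.domain ∧ (∑ c : Fin (k₁+1) → Finset (Fin (2*k₁+2)), if ((∀ i : Fin (k₁+1), (c i).Nonempty ∧ (∀ e ∈ c i, (Matrix.of fun (p : {p // p ∈ (c i).erase e}) (v : Fin (k₁+2)) => ((if (E₁ p.1).1 = v then (1:ℚ) else 0) - (if (E₁ p.1).2 = v then (1:ℚ) else 0))).rank = (Matrix.of fun (p : {p // p ∈ c i}) (v : Fin (k₁+2)) => ((if (E₁ p.1).1 = v then (1:ℚ) else 0) - (if (E₁ p.1).2 = v then (1:ℚ) else 0))).rank) ∧ (c i).card - (Matrix.of fun (p : {p // p ∈ c i}) (v : Fin (k₁+2)) => ((if (E₁ p.1).1 = v then (1:ℚ) else 0) - (if (E₁ p.1).2 = v then (1:ℚ) else 0))).rank = i.val + 1) ∧ (∀ i j : Fin (k₁+1), i < j → c i ⊂ c j) ∧ c (Fin.last k₁) = Finset.univ) then ((c 0).card : ℚ) * (∏ i : Fin k₁, (((c i.succ).card : ℚ) - ((c i.castSucc).card : ℚ))) / (∏ i : Fin k₁, (((c i.castSucc).card : ℚ) - 2 * ((i.val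 : ℚ) + 1))) else 0) = (∑ c : Fin (k₂+1) → Finset (Fin (2*k₂+2)), if ((∀ i : Fin (k₂+1), (c i).Nonempty ∧ (∀ e ∈ c i, (Matrix.of fun (p : {p // p ∈ (c i).erase e}) (v : Fin (k₂+2)) => ((if (E₂ p.1).1 = v then (1:ℚ) else 0) - (if (E₂ p.1).2 = v then (1:ℚ) else 0))).rank = (Matrix.of fun (p : {p // p ∈ c i}) (v : Fin (k₂+2)) => ((if (E₂ p.1).1 = v then (1:ℚ) else 0) - (if (E₂ p.1).2 = v then (1:ℚ) else 0))).rank) ∧ (c i).card - (Matrix.of fun (p : {p // p ∈ c i}) (v : Fin (k₂+2)) => ((if (E₂ p.1).1 = v then (1:ℚ) else 0) - (if (E₂ p.1).2 = v then (1:ℚ) else 0))).rank = i.val + 1) ∧ (∀ i j : Fin (k₂+1), i < j → c i ⊂ c j) ∧ c (Fin.last k₂) = Finset.univ) then ((c 0).card : ℚ) * (∏ i : Fin k₂, (((c i.succ).card : ℚ) - ((c i.castSucc).card : ℚ))) / (∏ i : Fin k₂, (((c i.castSucc).card : ℚ) - 2 * ((i.val : ℚ) + 1))) else 0) ∧ d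 = Literature.NumberTheory.Transcendental.KZ.of r₁ - Literature.NumberTheory.Transcendental.KZ.of r₂} ⊆ (KZ.relations : Set KZ.FormalRep) := by
  constructor
  · rintro hT d ⟨k₁, k₂, E₁, E₂, r₁, r₂, hd₁, hd₂, hdom₁, hint₁, hdom₂, hint₂, hH, rfl⟩
    exact hT k₁ k₂ E₁ E₂ hd₁ hd₂ r₁ r₂ hdom₁ hint₁ hdom₂ hint₂ hH
  · intro h k₁ k₂ E₁ E₂ hd₁ hd₂ r₁ r₂ hdom₁ hint₁ hdom₂ hint₂ hH
    exact h ⟨k₁, k₂, E₁, E₂, r₁, r₂, hd₁, hd₂, hdom₁, hint₁, hdom₂, hint₂, hH, rfl⟩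

/-- **The crux is verbatim Conjecture 1 of the enlarged calculus `KZ^H`**: `PhiFourKernelH` ⇔ "any
two representations of KZ's literal §1.1 shape with the same value are connected by rules
1), 2), 3) together with the rule `Hepp-equal φ⁴ parametric representations are interchangeable`"
— the summit statement `KontsevichZagierPeriods` with `KZ.relations` replaced by the enlarged
closure, nothing else changed. Instance `S' := S_H` of `kernelFormEnlarged_iff_conjectureOne_enlarged`.
[cite: KontsevichZagier2001, §1.2 Conjecture 1] [cite: Panzer2022, Conj. 1.2] -/
theorem phiFourKernelH_iff_conjectureOne_heppEnlarged :
    PhiFourKernelH ↔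
      ∀ ⦃n m : ℕ⦄ (r : KZ.IntegralRep n) (r' : KZ.IntegralRep m),
        r.IsRational → r'.IsRational → r.value = r'.value →
          KZ.of r - KZ.of r' ∈ AddSubgroup.closure (Literature.NumberTheory.Transcendental.KZ.domainAddRel ∪ Literature.NumberTheory.Transcendental.KZ.integrandAddRel ∪ Literature.NumberTheory.Transcendental.KZ.changeOfVariablesRel ∪ Literature.NumberTheory.Transcendental.KZ.newtonLeibnizRel ∪ {d : Literature.NumberTheory.Transcendental.KZ.FormalRep | ∃ (k₁ k₂ : ℕ) (E₁ : Fin (2*k₁+2) → Fin (k₁+2) × Fin (k₁+2)) (E₂ : Fin (2*k₂+2) → Fin (k₂+2) × Fin (k₂+2)) (r₁ : Literature.NumberTheory.Transcendental.KZ.IntegralRep (2*k₁+1)) (r₂ : Literature.NumberTheory.Transcendental.KZ.IntegralRep (2*k₂+1)), (∀ v, (Finset.univ.filter fun e => (E₁ e).1 = v ∨ (E₁ e).2 = v).card ≤ 4) ∧ (∀ v, (Finset.univ.filter fun e => (E₂ e).1 = v ∨ (E₂ e).2 = v).card ≤ 4) ∧ r₁.domain = {x | ∀ j, 0 < x j}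 ∧ Set.EqOn r₁.integrand (fun x => 1 / ((Matrix.fromBlocks (Matrix.diagonal (Fin.snoc x (1:ℝ) : Fin (2*k₁+2) → ℝ)) (Matrix.of fun (e : Fin (2*k₁+2)) (j : Fin (k₁+1)) => ((if (E₁ e).1 = j.succ then (1:ℝ) else 0) - (if (E₁ e).2 = j.succ then (1:ℝ) else 0))) (-(Matrix.of fun (e : Fin (2*k₁+2)) (j : Fin (k₁+1)) => ((if (E₁ e).1 = j.succ then (1:ℝ) else 0) - (if (E₁ e).2 = j.succ then (1:ℝ) else 0))).transpose) (0 : Matrix (Fin (k₁+1)) (Fin (k₁+1)) ℝ)).det) ^ 2) r₁.domain ∧ r₂.domain = {x | ∀ j, 0 < x j} ∧ Set.EqOn r₂.integrand (fun x => 1 / ((Matrix.fromBlocks (Matrix.diagonal (Fin.snoc x (1:ℝ) : Fin (2*k₂+2) → ℝ)) (Matrix.of fun (e : Fin (2*k₂+2)) (j : Fin (k₂+1)) => ((if (E₂ e).1 = j.succ then (1:ℝ) else 0) - (if (E₂ e).2 = j.succ then (1:ℝ) else 0))) (-(Matrix.of fun (e : Fin (2*k₂+2)) (j : Fin (k₂+1))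 => ((if (E₂ e).1 = j.succ then (1:ℝ) else 0) - (if (E₂ e).2 = j.succ then (1:ℝ) else 0))).transpose) (0 : Matrix (Fin (k₂+1)) (Fin (k₂+1)) ℝ)).det) ^ 2) r₂.domain ∧ (∑ c : Fin (k₁+1) → Finset (Fin (2*k₁+2)), if ((∀ i : Fin (k₁+1), (c i).Nonempty ∧ (∀ e ∈ c i, (Matrix.of fun (p : {p // p ∈ (c i).erase e}) (v : Fin (k₁+2)) => ((if (E₁ p.1).1 = v then (1:ℚ) else 0) - (if (E₁ p.1).2 = v then (1:ℚ) else 0))).rank = (Matrix.of fun (p : {p // p ∈ c i}) (v : Fin (k₁+2)) => ((if (E₁ p.1).1 = v then (1:ℚ) else 0) - (if (E₁ p.1).2 = v then (1:ℚ) else 0))).rank) ∧ (c i).card - (Matrix.of fun (p : {p // p ∈ c i}) (v : Fin (k₁+2)) => ((if (E₁ p.1).1 = v then (1:ℚ) else 0) - (if (E₁ p.1).2 = v then (1:ℚ) else 0))).rank = i.val + 1) ∧ (∀ i j : Fin (k₁+1), i < j → c i ⊂ c j) ∧ c (Fin.last k₁) = Finset.univ) then ((c 0).card : ℚ) * (∏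 i : Fin k₁, (((c i.succ).card : ℚ) - ((c i.castSucc).card : ℚ))) / (∏ i : Fin k₁, (((c i.castSucc).card : ℚ) - 2 * ((i.val : ℚ) + 1))) else 0) = (∑ c : Fin (k₂+1) → Finset (Fin (2*k₂+2)), if ((∀ i : Fin (k₂+1), (c i).Nonempty ∧ (∀ e ∈ c i, (Matrix.of fun (p : {p // p ∈ (c i).erase e}) (v : Fin (k₂+2)) => ((if (E₂ p.1).1 = v then (1:ℚ) else 0) - (if (E₂ p.1).2 = v then (1:ℚ) else 0))).rank = (Matrix.of fun (p : {p // p ∈ c i}) (v : Fin (k₂+2)) => ((if (E₂ p.1).1 = v then (1:ℚ) else 0) - (if (E₂ p.1).2 = v then (1:ℚ) else 0))).rank) ∧ (c i).card - (Matrix.of fun (p : {p // p ∈ c i}) (v : Fin (k₂+2)) => ((if (E₂ p.1).1 = v then (1:ℚ) else 0) - (if (E₂ p.1).2 = v then (1:ℚ) else 0))).rank = i.val + 1) ∧ (∀ i j : Fin (k₂+1), i < j → c i ⊂ c j) ∧ c (Fin.last k₂) = Finset.univ) then ((c 0).card : ℚ) * (∏ i : Fin k₂, (((c i.succ).card : ℚ)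 - ((c i.castSucc).card : ℚ))) / (∏ i : Fin k₂, (((c i.castSucc).card : ℚ) - 2 * ((i.val : ℚ) + 1))) else 0) ∧ d = Literature.NumberTheory.Transcendental.KZ.of r₁ - Literature.NumberTheory.Transcendental.KZ.of r₂}) :=
  kernelFormEnlarged_iff_conjectureOne_enlarged _

/-- **The bet implies Panzer's Conjecture 1.2 (⇐) in the crux's coordinates** (`HeppValueSound`:
Hepp-equal `φ⁴` parametric data have equal VALUE): soundness of the moves
(`KZ.Equivalent.value_eq`). [cite: Panzer2022, Conj. 1.2] [cite: KontsevichZagier2001, §1.2] -/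
theorem heppValueSound_of_tropicalLifting (hT : TropicalLifting) :
    ∀ (k₁ k₂ : ℕ) (E₁ : Fin (2*k₁+2) → Fin (k₁+2) × Fin (k₁+2)) (E₂ : Fin (2*k₂+2) → Fin (k₂+2) × Fin (k₂+2)), (∀ v, (Finset.univ.filter fun e => (E₁ e).1 = v ∨ (E₁ e).2 = v).card ≤ 4) → (∀ v, (Finset.univ.filter fun e => (E₂ e).1 = v ∨ (E₂ e).2 = v).card ≤ 4) → ∀ (r₁ : Literature.NumberTheory.Transcendental.KZ.IntegralRep (2*k₁+1)) (r₂ : Literature.NumberTheory.Transcendental.KZ.IntegralRep (2*k₂+1)), r₁.domain = {x | ∀ j, 0 < x j} → Set.EqOn r₁.integrand (fun x => 1 / ((Matrix.fromBlocks (Matrix.diagonal (Fin.snoc x (1:ℝ) : Fin (2*k₁+2) → ℝ)) (Matrix.of fun (e : Fin (2*k₁+2)) (j : Fin (k₁+1)) => ((if (E₁ e).1 = j.succ then (1:ℝ) else 0) - (if (E₁ e).2 = j.succ then (1:ℝ) else 0))) (-(Matrix.of fun (e : Fin (2*k₁+2)) (j : Fin (k₁+1)) => ((if (E₁ e).1 =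 j.succ then (1:ℝ) else 0) - (if (E₁ e).2 = j.succ then (1:ℝ) else 0))).transpose) (0 : Matrix (Fin (k₁+1)) (Fin (k₁+1)) ℝ)).det) ^ 2) r₁.domain → r₂.domain = {x | ∀ j, 0 < x j} → Set.EqOn r₂.integrand (fun x => 1 / ((Matrix.fromBlocks (Matrix.diagonal (Fin.snoc x (1:ℝ) : Fin (2*k₂+2) → ℝ)) (Matrix.of fun (e : Fin (2*k₂+2)) (j : Fin (k₂+1)) => ((if (E₂ e).1 = j.succ then (1:ℝ) else 0) - (if (E₂ e).2 = j.succ then (1:ℝ) else 0))) (-(Matrix.of fun (e : Fin (2*k₂+2)) (j : Fin (k₂+1)) => ((if (E₂ e).1 = j.succ then (1:ℝ) else 0) - (if (E₂ e).2 = j.succ then (1:ℝ) else 0))).transpose) (0 : Matrix (Fin (k₂+1)) (Fin (k₂+1)) ℝ)).det) ^ 2) r₂.domain → (∑ c : Fin (k₁+1) → Finset (Fin (2*k₁+2)), if ((∀ i : Fin (k₁+1), (c i).Nonempty ∧ (∀ e ∈ c i, (Matrix.of fun (p : {p // p ∈ (c i).erase e}) (v : Fin (k₁+2)) => ((if (E₁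 p.1).1 = v then (1:ℚ) else 0) - (if (E₁ p.1).2 = v then (1:ℚ) else 0))).rank = (Matrix.of fun (p : {p // p ∈ c i}) (v : Fin (k₁+2)) => ((if (E₁ p.1).1 = v then (1:ℚ) else 0) - (if (E₁ p.1).2 = v then (1:ℚ) else 0))).rank) ∧ (c i).card - (Matrix.of fun (p : {p // p ∈ c i}) (v : Fin (k₁+2)) => ((if (E₁ p.1).1 = v then (1:ℚ) else 0) - (if (E₁ p.1).2 = v then (1:ℚ) else 0))).rank = i.val + 1) ∧ (∀ i j : Fin (k₁+1), i < j → c i ⊂ c j) ∧ c (Fin.last k₁) = Finset.univ) then ((c 0).card : ℚ) * (∏ i : Fin k₁, (((c i.succ).card : ℚ) - ((c i.castSucc).card : ℚ))) / (∏ i : Fin k₁, (((c i.castSucc).card : ℚ) - 2 * ((i.val : ℚ) + 1))) else 0) = (∑ c : Fin (k₂+1) → Finset (Fin (2*k₂+2)), if ((∀ i : Fin (k₂+1), (c i).Nonempty ∧ (∀ e ∈ c i, (Matrix.of fun (p : {p // p ∈ (c i).erase e}) (v : Fin (k₂+2)) => ((if (E₂ p.1).1 = v then (1:ℚ) else 0)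 - (if (E₂ p.1).2 = v then (1:ℚ) else 0))).rank = (Matrix.of fun (p : {p // p ∈ c i}) (v : Fin (k₂+2)) => ((if (E₂ p.1).1 = v then (1:ℚ) else 0) - (if (E₂ p.1).2 = v then (1:ℚ) else 0))).rank) ∧ (c i).card - (Matrix.of fun (p : {p // p ∈ c i}) (v : Fin (k₂+2)) => ((if (E₂ p.1).1 = v then (1:ℚ) else 0) - (if (E₂ p.1).2 = v then (1:ℚ) else 0))).rank = i.val + 1) ∧ (∀ i j : Fin (k₂+1), i < j → c i ⊂ c j) ∧ c (Fin.last k₂) = Finset.univ) then ((c 0).card : ℚ) * (∏ i : Fin k₂, (((c i.succ).card : ℚ) - ((c i.castSucc).card : ℚ))) / (∏ i : Fin k₂, (((c i.castSucc).card : ℚ) - 2 * ((i.val : ℚ) + 1))) else 0) → r₁.value = r₂.value := by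
  intro k₁ k₂ E₁ E₂ hd₁ hd₂ r₁ r₂ hdom₁ hint₁ hdom₂ hint₂ hH
  exact KZ.Equivalent.value_eq_holds (hT k₁ k₂ E₁ E₂ hd₁ hd₂ r₁ r₂ hdom₁ hint₁ hdom₂ hint₂ hH)

/-- **Conjunct reading of route PhiFourHepp.** `(KontsevichZagierPeriods ∧ HeppValueSound) ↔
(TropicalLifting ∧ PhiFourKernelH)`, `HeppValueSound` = Panzer's Conj. 1.2 (⇐) written in the
crux's inlined coordinates (Hepp-equal `φ⁴` parametric data have equal value). The route's two
open cruxes are JOINTLY EQUIVALENT to "the summit plus the value-soundness of the Hepp scheme":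
`TropicalLifting` is the attacked conjunct (the `φ⁴`/Hepp sector of Conjecture 1), `PhiFourKernelH`
the complementary conjunct (Conjecture 1 with that sector quotiented out) — the residual. Instance
`S' := S_H` of `summit_and_sound_iff_subset_and_kernelFormEnlarged`. [cite: Panzer2022, Conj. 1.2] [cite: KontsevichZagier2001, §1.2 Conjecture 1] -/
theorem summit_and_heppValueSound_iff_cruxes :
    (KontsevichZagierPeriods ∧
      ∀ (k₁ k₂ : ℕ) (E₁ : Fin (2*k₁+2) → Fin (k₁+2) × Fin (k₁+2)) (E₂ : Fin (2*k₂+2) → Fin (k₂+2) × Fin (k₂+2)), (∀ v, (Finset.univ.filter fun e => (E₁ e).1 = v ∨ (E₁ e).2 = v).card ≤ 4) → (∀ v, (Finset.univ.filter fun e => (E₂ e).1 = v ∨ (E₂ e).2 = v).card ≤ 4) → ∀ (r₁ : Literature.NumberTheory.Transcendental.KZ.IntegralRep (2*k₁+1)) (r₂ : Literature.NumberTheory.Transcendental.KZ.IntegralRep (2*k₂+1)), r₁.domain = {x | ∀ j, 0 < x j} → Set.EqOn r₁.integrand (fun x => 1 / ((Matrix.fromBlocks (Matrix.diagonal (Fin.snoc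 x (1:ℝ) : Fin (2*k₁+2) → ℝ)) (Matrix.of fun (e : Fin (2*k₁+2)) (j : Fin (k₁+1)) => ((if (E₁ e).1 = j.succ then (1:ℝ) else 0) - (if (E₁ e).2 = j.succ then (1:ℝ) else 0))) (-(Matrix.of fun (e : Fin (2*k₁+2)) (j : Fin (k₁+1)) => ((if (E₁ e).1 = j.succ then (1:ℝ) else 0) - (if (E₁ e).2 = j.succ then (1:ℝ) else 0))).transpose) (0 : Matrix (Fin (k₁+1)) (Fin (k₁+1)) ℝ)).det) ^ 2) r₁.domain → r₂.domain = {x | ∀ j, 0 < x j} → Set.EqOn r₂.integrand (fun x => 1 / ((Matrix.fromBlocks (Matrix.diagonal (Fin.snoc x (1:ℝ) : Fin (2*k₂+2) → ℝ)) (Matrix.of fun (e : Fin (2*k₂+2)) (j : Fin (k₂+1)) => ((if (E₂ e).1 = j.succ then (1:ℝ) else 0) - (if (E₂ e).2 = j.succ then (1:ℝ) else 0))) (-(Matrix.of fun (e : Fin (2*k₂+2)) (j : Fin (k₂+1)) => ((if (E₂ e).1 = j.succ then (1:ℝ) else 0) - (if (E₂ e).2 = j.succ then (1:ℝ) else 0))).transpose)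 (0 : Matrix (Fin (k₂+1)) (Fin (k₂+1)) ℝ)).det) ^ 2) r₂.domain → (∑ c : Fin (k₁+1) → Finset (Fin (2*k₁+2)), if ((∀ i : Fin (k₁+1), (c i).Nonempty ∧ (∀ e ∈ c i, (Matrix.of fun (p : {p // p ∈ (c i).erase e}) (v : Fin (k₁+2)) => ((if (E₁ p.1).1 = v then (1:ℚ) else 0) - (if (E₁ p.1).2 = v then (1:ℚ) else 0))).rank = (Matrix.of fun (p : {p // p ∈ c i}) (v : Fin (k₁+2)) => ((if (E₁ p.1).1 = v then (1:ℚ) else 0) - (if (E₁ p.1).2 = v then (1:ℚ) else 0))).rank) ∧ (c i).card - (Matrix.of fun (p : {p // p ∈ c i}) (v : Fin (k₁+2)) => ((if (E₁ p.1).1 = v then (1:ℚ) else 0) - (if (E₁ p.1).2 = v then (1:ℚ) else 0))).rank = i.val + 1) ∧ (∀ i j : Fin (k₁+1), i < j → c i ⊂ c j) ∧ c (Fin.last k₁) = Finset.univ) then ((c 0).card : ℚ) * (∏ i : Fin k₁, (((c i.succ).card : ℚ) - ((c i.castSucc).card : ℚ))) / (∏ i : Fin k₁, (((c i.castSucc).card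 : ℚ) - 2 * ((i.val : ℚ) + 1))) else 0) = (∑ c : Fin (k₂+1) → Finset (Fin (2*k₂+2)), if ((∀ i : Fin (k₂+1), (c i).Nonempty ∧ (∀ e ∈ c i, (Matrix.of fun (p : {p // p ∈ (c i).erase e}) (v : Fin (k₂+2)) => ((if (E₂ p.1).1 = v then (1:ℚ) else 0) - (if (E₂ p.1).2 = v then (1:ℚ) else 0))).rank = (Matrix.of fun (p : {p // p ∈ c i}) (v : Fin (k₂+2)) => ((if (E₂ p.1).1 = v then (1:ℚ) else 0) - (if (E₂ p.1).2 = v then (1:ℚ) else 0))).rank) ∧ (c i).card - (Matrix.of fun (p : {p // p ∈ c i}) (v : Fin (k₂+2)) => ((if (E₂ p.1).1 = v then (1:ℚ) else 0) - (if (E₂ p.1).2 = v then (1:ℚ) else 0))).rank = i.val + 1) ∧ (∀ i j : Fin (k₂+1), i < j → c i ⊂ c j) ∧ c (Fin.last k₂) = Finset.univ) then ((c 0).card : ℚ) * (∏ i : Fin k₂, (((c i.succ).card : ℚ) - ((c i.castSucc).card : ℚ))) / (∏ i : Fin k₂, (((c i.castSucc).card : ℚ) - 2 * ((i.val : ℚ)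 + 1))) else 0) → r₁.value = r₂.value) ↔
      (TropicalLifting ∧ PhiFourKernelH) := by
  rw [tropicalLifting_iff_heppScheme_subset_relations]
  refine Iff.trans ?_ (summit_and_sound_iff_subset_and_kernelFormEnlarged _)
  refine and_congr_right fun _ => ?_
  constructor
  · rintro hHS d ⟨k₁, k₂, E₁, E₂, r₁, r₂, hd₁, hd₂, hdom₁, hint₁, hdom₂, hint₂, hH, rfl⟩
    rw [KZ.eval_of_sub_of, hHS k₁ k₂ E₁ E₂ hd₁ hd₂ r₁ r₂ hdom₁ hint₁ hdom₂ hint₂ hH, sub_self]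
  · intro h k₁ k₂ E₁ E₂ hd₁ hd₂ r₁ r₂ hdom₁ hint₁ hdom₂ hint₂ hH
    have := h _ ⟨k₁, k₂, E₁, E₂, r₁, r₂, hd₁, hd₂, hdom₁, hint₁, hdom₂, hint₂, hH, rfl⟩
    rwa [KZ.eval_of_sub_of, sub_eq_zero] at this

/-- **Every decomposition of the crux decides the summit given the bet**: if `X → PhiFourKernelH`
then `X → TropicalLifting → KontsevichZagierPeriods` (and conversely `X → summit` gives
`X → PhiFourKernelH` by `kernelOfSummitR_proof`). The pieces of any split of `PhiFourKernelH` are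
therefore pieces of a split of the summit relative to `TropicalLifting`. [folklore] -/
theorem summit_of_sufficient_for_phiFourKernelH {X : Prop} (hX : X → PhiFourKernelH)
    (hT : TropicalLifting) (x : X) : KontsevichZagierPeriods :=
  closes hT (hX x)

end Summit.KontsevichZagierPeriods.PhiFourHepp
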